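import Summits.RiemannHypothesis.RiemannHypothesis.Theorems.IntegerScrewDiscreteLandau

/-!
# `Lines/PowerSparseDetect_special.lean` — F3 / BC5 WITNESS for line `power-sparse-detect`
(crux `IntegerScrew.ScrewPolyFloor`, stmt-RiemannHypothesis-15757; rung harvest fwd-harvest RiemannHypothesis/01)

* rung_decl : `Summit.RiemannHypothesis.RiemannHypothesis.Theses.SparseScrew.PowerSparseDetect`
* witness   : `Summit.RiemannHypothesis.RiemannHypothesis.Theorems.IntegerScrewDiscreteLandau.DiscreteLandau_proof`
              (route item stmt-RiemannHypothesis-15758, PROVED) — the rung family `Rung C θ` at the floor parameter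
              `C = 0` IS the seed: density with `C = 0` forces every `m ≥ 1` into `A` (`Rung_special`, 5 lines),
              and the seed's literal statement is recovered from the family (`example` below).
* why it is a witness of weakness and not of S: `Rung 0 θ` is a theorem NOW (no RH), while the rung
  `PowerSparseDetect = ∀ θ < 1, ∀ C, Rung C θ` needs the new lever (Ω-depth + rise bound + dense hits,
  `Lines/PowerSparseDetect.lean` stubs S1–S3) and S = RH is untouched by either.
Sorry-free. Defs = verbatim copy of the forward seat's Sketch.lean (same as in `Lines/PowerSparseDetect.lean`).
-/

set_option linter.dupNamespace false
namespace Summit.RiemannHypothesis.RiemannHypothesis.Theses.SparseScrew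

def SparseDetect (A : Set ℕ) : Prop :=
  (∀ m ∈ A, 0 ≤ Literature.NumberTheory.LFunctions.zetaScrew (Real.log m)) → RiemannHypothesis

def Rung (C θ : ℝ) : Prop :=
  ∀ A : Set ℕ, (∀ m : ℕ, 1 ≤ m → ∃ a ∈ A, m ≤ a ∧ (a : ℝ) ≤ m + C * (m : ℝ) ^ θ) → SparseDetect A

def SqrtSparseDetect : Prop :=
  ∀ C : ℝ, Rung C (1 / 2)

def PowerSparseDetect : Prop :=
  ∀ θ : ℝ, θ < 1 → ∀ C : ℝ, Rung C θ

def SubexpSlackDetect : Prop :=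
  (∀ ε : ℝ, 0 < ε → ∃ K : ℝ, ∀ m : ℕ, 1 ≤ m →
      -K * (m : ℝ) ^ ε ≤ Literature.NumberTheory.LFunctions.zetaScrew (Real.log m)) → RiemannHypothesis

end Summit.RiemannHypothesis.RiemannHypothesis.Theses.SparseScrew

open Summit.RiemannHypothesis.RiemannHypothesis.Theses.SparseScrew

/-- the floor, as a member of the family (5-line proof allowed by F3: `C = 0` ⇒ `a = m`). -/
theorem Rung_special (θ : ℝ) : Rung 0 θ := by
  intro A hA hpos
  refine Summit.RiemannHypothesis.RiemannHypothesis.Theorems.IntegerScrewDiscreteLandau.DiscreteLandau_proof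
    fun m hm ↦ ?_
  obtain ⟨a, haA, hma, ham⟩ := hA m hm
  have hle : (a : ℝ) ≤ m := by simpa using ham
  have hma' : a = m := le_antisymm (by exact_mod_cast hle) hma
  exact hma' ▸ hpos a haA

/-- literally the seed's statement, recovered from the family (sanity). -/
example : Summit.RiemannHypothesis.RiemannHypothesis.Theses.IntegerScrew.DiscreteLandau := by
  intro h
  exact Rung_special 0 {m | 1 ≤ m} (fun m hm ↦ ⟨m, hm, le_rfl, by simp⟩) (fun m hm ↦ h m hm)
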